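import Literature.Probability.RandomPlanarGeometry.HexSAWSurfaceWallDelayedRenewal
import Literature.Probability.RandomPlanarGeometry.HexSAWSurfaceWallRenewalCubeRange
import HarnessLib

/-!
# Six steps per visit plus four for the DELAY pieces of honeycomb wall bridges, and the delayed renewal theorem for ALL wall
# bridges down to `y > μ³ = (2+√2)^{3/2}`

Topic `Literature/Probability/RandomPlanarGeometry` (lane «pcv-sawmu», a-p6 g19, car «SIX-STEP-DELAY»; parents:
`HexSAWSurfaceWallDelayedRenewal.lean` (a-idea-1 g28: wall-cut times `IsWCut`, delay pieces `dwb n` = wall bridges with no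
wall-cut time `< n`, `D_n(y) = DWB n y`, the delayed renewal identity `W_n = Σ_k D_k P_{n−k}`, the normalised pair
`w_s = wbAmp y s = W_{2s}/β^{2s}`, `d_k = dwbLaw y k = D_{2k}/β^{2k}`, the delay mass `d(y) = dwbSum y`, the entropy lemma
`four_mul_visits_le_dwb : 4·visits ≤ n + 2` and, for `y > μ⁴`, `summable_dwbLaw` and the delayed renewal theorem `tendsto_wbAmp`);
`HexSAWSurfaceWallRenewalCubeRange.lean` (a-p6 g19: the positive-wall-bridge renewal theorem `tendsto_pwbAmp_of_cube_lt`,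
`pwbMean_pos_of_cube_lt`, `two_sub_pwbMean_mul_pow_le_WB_of_cube_lt`, `theta_cube_lt_one` on `y > μ³`, built on the six-step law
of `HexSAWSurfaceWallRenewalSixStep.lean` (a-idea-1 g33)); the step bookkeeping `step_cases`, `steps_count`, `exists_descent`,
`wallTimes`, `visits_eq_card`, `parity_apply`, `brickWallGraph_adj_coord` of `HexSAWSurfaceWallRenewal.lean` / `HexSAWBrickWallWalks.lean`
/ `SAWBrickWallHex.lean`; the general renewal theorem `Process/RenewalTheoremGeneral.lean` (`Renewal.tendsto_sum_antidiagonal_mul`)).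

THE LAW (§3).  A delay piece `ω ∈ dwb n`, `n ≥ 1`, has **`6 · visits + 4 ≤ n`** (`six_mul_visits_add_four_le_dwb`), with equality for
the iterated hooks with a dive to column `0` (lengths `10, 16, 22, …`; the exact census of delay pieces to length `22` on this
lane has `max visits = ⌊(n−4)/6⌋` at every length, and the law was conjectured from it).  It sharpens the parent's
`four_mul_visits_le_dwb : 4·visits ≤ n + 2` exactly as the six-step law `six_mul_visits_le : 6·visits ≤ n` of
`HexSAWSurfaceWallRenewalSixStep.lean` sharpens `four_mul_visits_le` for irreducible positive wall bridges; the extra `+4` is the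
price of the forced return to the column `X = 0` (`exists_return_zero_dwb`: `0` is not a wall-cut time).  PROOF (a charging,
§2–§3): `n = X_n + 2·#left + 2·#down` (`#up = #down`, `X_n = #right − #left`); `X_n ≥ 2·visits + 2` (`two_mul_visits_add_two_le_dwb`:
the visits occupy distinct even columns of `(0, X_n]`, and the even column after the FIRST dive is never visited); and
`2·visits + 1 ≤ #left + #down` (`two_mul_visits_add_one_le_card_dwb`): every interior visit `t` (even column `x = X_t ≥ 2`) is
left along the wall (`wall_step_horizontal_hpw` — the even wall site has no downward bond in the brick wall) and, not being a
wall-cut time, is either preceded by an overhang over column `x` or followed by a weak return to it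
(`exists_return_of_no_overhang_dwb`); so it owns a LEFT step landing on column `x` (the step into it; a step of the descent from
the overhang; or a step of the return) and a second token — a left step landing on `x − 1` (left-type and overhang-type
visits), a left step landing on `x + 1` (return-type visits followed by a second right step) or the dive at time `t + 1`
(return-type visits followed by a dive) — never the LAST dive (`exists_later_down_step_dwb`), which is the final visit's token;
the return to column `0` gives a left step landing on column `0`, and one more free token: a left step landing on column `1`
when the first run has length `≥ 3` (then column `2`'s visit is return-type and claims nothing on column `1`), the FIRST dive
when the first run has length `1` (it is not the last dive, `exists_down_step_after_one_dwb`: the walk must come back to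
`(0, −1)`, which has no upward bond).  All tokens are distinct left/down steps.

THE CONSEQUENCE (§4).  Per block `y^{visits} ≤ y^{⌊(s−2)/3⌋}` on `dwb (2s)`, hence `D_{2s}(y) ≤ μ^{2s+2} y^{⌊(s−2)/3⌋}`
(`DWB_le_pow_mul_pow_sub_div_three`) and the delay law has the geometric envelope `d_k(y) ≤ μ² · θ₃(y)^k`, `θ₃(y) = μ²/y^{2/3}`
(`dwbLaw_le_geom_cube`), `< 1` iff `y > μ³`: the delay mass is summable on `y > μ³` (`summable_dwbLaw_of_cube_lt`,
`1 ≤ d(y) ≤ μ²/(1−θ₃)`), and with `HexSAWSurfaceWallRenewalCubeRange` the tree's dominated-convergence lemma gives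
★★ `tendsto_wbAmp_of_cube_lt : W_{2s}(y)/β(y)^{2s} → d(y)/m(y)` — the DELAYED RENEWAL THEOREM FOR ALL WALL BRIDGES
[MadrasSlade1993, §4.2, Theorem 4.2.2(b)] now on `y > μ³ = (2+√2)^{3/2} ≈ 6.31` (parent: `y > μ⁴ ≈ 11.66`) — with the explicit
positive limit bounds `wbAmp_lim_bounds_of_cube_lt`, the ratio limit `tendsto_WB_ratio_of_cube_lt : W_{2s+2}/W_{2s} → β(y)²`, the
eventual two-sided constants `eventually_WB_two_sided_of_cube_lt` and the all-`s` sandwich `WB_two_sided_all_of_cube_lt`.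
§5 (ed.2, THE DELAY GAP): `one_le_visits_of_mem_dwb`, `ten_le_of_mem_dwb` (every delay piece of positive length has length `≥ 10`),
`dwb_eq_empty_of_lt_ten`, `DWB_eq_zero_of_lt_ten`, `dwbLaw_eq_zero_of_lt_five` (`d_1 = ⋯ = d_4 = 0`), ★ `dwbSum_sub_one_le_of_cube_lt :
d(y) − 1 ≤ μ²θ₃⁵/(1−θ₃)` and `wbAmp_lim_window_of_cube_lt : 1/m ≤ d/m ≤ (1 + μ²θ₃⁵/(1−θ₃))/m` — all wall bridges and positive wall bridges
have the same pure-exponential amplitude to relative order `θ₃⁵`.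

HONEST LABEL.  LANE THEOREM: §3 is NEW lane mathematics (the `+4` law for delay pieces, conjectured from the lane's census and
proved here by an elementary charging); §4 is a RANGE EXTENSION, DERIVED (the parent's §4–§5 with its entropy envelope replaced by
the new one and `HexSAWSurfaceWallRenewalCubeRange` supplying the positive-bridge inputs).  NEW IN WRITING (modest): the visits/length
law for delay pieces and the delayed renewal theorem for surface-weighted honeycomb wall bridges on the explicit range
`y > (2+√2)^{3/2}`; print has the renewal structure for unweighted bridges [MadrasSlade1993, §4.2, Theorem 4.2.2 and Appendix B;
Kesten1963SAW, §4], the prime/decomposable dissection of interacting models [JansevanRensburg2000, §5.2.3] and, for honeycomb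
bridges at `y = 1`, [BeatonBousquetMelouDeGierDuminilCopinGuttmann2014, Appendix]; no visits/length law for delay pieces and no
explicit fugacity range for the delayed theorem were found in the lane's held corpus (the parents' searches).  Sources of the
ingredients AS PRINTED: [MadrasSlade1993, §1.1–§1.2 (walks, steps, bridges: Definition 1.2.4, (1.2.16)–(1.2.17), p. 11), §4.2
(Definition 4.2.1, Theorem 4.2.2 (pp. 90–92), the remark before (4.2.21) (p. 94)), Appendix B (Theorem B.1)]; [Feller1968, XIII.3,
XIII.5]; [HammersleyTorrieWhittington1982, §2 (surface bridges)]; the brick-wall frame [EntingJensen2009, §7.4.2, Fig. 7.10]; the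
surface visits of the honeycomb half-plane [BeatonBousquetMelouDeGierDuminilCopinGuttmann2014, §3.1 (arXiv v5 p. 8)].  NOT claimed:
the equality case of the law, anything for `y ≤ μ³`, the explicit rate of the delayed theorem on the new range (the parent's §6
template would carry over; not done here), numerics.  No definitions (the file is def-free).
-/

noncomputable section

open Finset Filter Function
open Literature.Probability.LatticeModels Literature.Probability.Percolation SimpleGraph
open Literature.Combinatorics.Enumerative
open _root_.Topology

namespace Literature.Probability.RandomPlanarGeometry.SAW.HexBW.Wall

variable {n : ℕ} {ω : ℕ → Site 2} {y : ℝ}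

/-! ### §1 Local structure of a half-plane brick-wall walk at its surface visits -/

/-- [folklore] Two coordinates determine a site of `ℤ²`. -/
private theorem site_ext_dsix {p q : Site 2} (h0 : p 0 = q 0) (h1 : p 1 = q 1) : p = q := by
  funext k
  fin_cases k
  · exact h0
  · exact h1

/-- The parity of a DOWN step of the brick wall: the lower endpoint `(X_{i+1}, Y_{i+1})` has even parity.
[cite: EntingJensen2009, §7.4.2, Fig. 7.10 (brickwork form of the honeycomb lattice)] -/
theorem down_step_parity (hbw : IsBW n ω) {i : ℕ} (hi : i < n)
    (hD : ω (i + 1) 0 = ω i 0 ∧ ω (i + 1) 1 = ω i 1 - 1) : (ω (i + 1) 0 + ω (i + 1) 1) % 2 = 0 := by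
  have h := (brickWallGraph_adj_coord _ _).1 (hbw i hi)
  omega

/-- The parity of an UP step of the brick wall: the lower endpoint `(X_i, Y_i)` has even parity.
[cite: EntingJensen2009, §7.4.2, Fig. 7.10 (brickwork form of the honeycomb lattice)] -/
theorem up_step_parity (hbw : IsBW n ω) {i : ℕ} (hi : i < n)
    (hU : ω (i + 1) 0 = ω i 0 ∧ ω (i + 1) 1 = ω i 1 + 1) : (ω i 0 + ω i 1) % 2 = 0 := by
  have h := (brickWallGraph_adj_coord _ _).1 (hbw i hi)
  omega

/-- **A surface visit is left along the wall** (half-plane walks): at a time `t < n` with `t` even and `Y_t = 0` the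
step `t → t+1` is horizontal — the even wall site `(X_t, 0)` has no downward bond in the brick wall and the upward bond
leaves the half-plane. [cite: BeatonBousquetMelouDeGierDuminilCopinGuttmann2014, §3.1 (arXiv v5 p. 8: surface sites of the honeycomb half-plane)] -/
theorem wall_step_horizontal_hpw (hh : ω ∈ hpw n) {t : ℕ} (htn : t < n) (ht2 : t % 2 = 0) (hY : ω t 1 = 0) :
    (ω (t + 1) 0 = ω t 0 + 1 ∨ ω (t + 1) 0 = ω t 0 - 1) ∧ ω (t + 1) 1 = 0 := by
  obtain ⟨hs, hhp⟩ := mem_hpw.1 hh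
  obtain ⟨-, -, hbw, -⟩ := mem_saws_iff.1 hs
  have hpar := parity_apply hs htn.le
  rw [hY, add_zero] at hpar
  rcases step_cases hbw htn with h | h | h | h
  · exact ⟨Or.inl h.1, by rw [h.2, hY]⟩
  · exact ⟨Or.inr h.1, by rw [h.2, hY]⟩
  · exact absurd (hhp (t + 1) (by omega)) (by rw [h.2, hY]; norm_num)
  · have hd := down_step_parity hbw htn h
    rw [h.1, h.2, hY] at hd
    omega

/-- **A surface visit is entered along the wall** (half-plane walks): at a time `1 ≤ t ≤ n` with `t` even and `Y_t = 0`
the step `t-1 → t` is horizontal. [cite: BeatonBousquetMelouDeGierDuminilCopinGuttmann2014, §3.1 (arXiv v5 p. 8: surface sites of the honeycomb half-plane)] -/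
theorem wall_prev_horizontal_hpw (hh : ω ∈ hpw n) {t : ℕ} (ht1 : 1 ≤ t) (htn : t ≤ n) (ht2 : t % 2 = 0)
    (hY : ω t 1 = 0) : (ω t 0 = ω (t - 1) 0 + 1 ∨ ω t 0 = ω (t - 1) 0 - 1) ∧ ω (t - 1) 1 = 0 := by
  obtain ⟨hs, hhp⟩ := mem_hpw.1 hh
  obtain ⟨-, -, hbw, -⟩ := mem_saws_iff.1 hs
  have hpar := parity_apply hs htn
  rw [hY, add_zero] at hpar
  have hlt : t - 1 < n := by omega
  rcases step_cases hbw hlt with h | h | h | h <;> rw [show t - 1 + 1 = t by omega] at h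
  · exact ⟨Or.inl h.1, by rw [← h.2, hY]⟩
  · exact ⟨Or.inr h.1, by rw [← h.2, hY]⟩
  · have hu := up_step_parity hbw hlt (by rw [show t - 1 + 1 = t by omega]; exact h)
    have : ω (t - 1) 1 = -1 := by rw [hY] at h; omega
    rw [← h.1, this] at hu
    omega
  · exact absurd (hhp (t - 1) (by omega)) (by rw [hY] at h; omega)

/-- **No reversal at a visit** (half-plane walks): a visit left by a LEFT step was entered by a left step
(`X_{t-1} = X_t + 1`); a visit left by a RIGHT step was entered by a right step (`X_{t-1} = X_t - 1`).
[cite: MadrasSlade1993, §1.1 (self-avoidance)] -/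
theorem wall_prev_of_step_hpw (hh : ω ∈ hpw n) {t : ℕ} (ht1 : 1 ≤ t) (htn : t < n) (ht2 : t % 2 = 0) (hY : ω t 1 = 0) :
    (ω (t + 1) 0 = ω t 0 - 1 → ω (t - 1) 0 = ω t 0 + 1) ∧ (ω (t + 1) 0 = ω t 0 + 1 → ω (t - 1) 0 = ω t 0 - 1) := by
  obtain ⟨hs, -⟩ := mem_hpw.1 hh
  obtain ⟨-, -, -, hinj⟩ := mem_saws_iff.1 hs
  obtain ⟨hprev, hYp⟩ := wall_prev_horizontal_hpw hh ht1 htn.le ht2 hY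
  obtain ⟨-, hYs⟩ := wall_step_horizontal_hpw hh htn ht2 hY
  have key : ω (t + 1) 0 ≠ ω (t - 1) 0 := fun h => by
    have := hinj (show t + 1 ∈ {i | i ≤ n} from Nat.succ_le_of_lt htn) (show t - 1 ∈ {i | i ≤ n} by
      simp only [Set.mem_setOf_eq]; omega) (site_ext_dsix h (by rw [hYs, hYp]))
    omega
  constructor <;> intro h <;> rcases hprev with h' | h' <;> omega

/-! ### §2 Delay pieces: the return to column `0`, the first dive, the unvisited column after it -/

/-- A delay piece is a half-plane walk. [cite: MadrasSlade1993, §4.2, Theorem 4.2.2 (the delay sequence)] -/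
theorem hpw_of_mem_dwb (hω : ω ∈ dwb n) : ω ∈ hpw n := archs_subset (wbr_subset (dwb_subset hω))

/-- **The return to column `0`.** A delay piece of length `n ≥ 1` revisits the column `X = 0` at some time `j ≥ 1`
(otherwise `0` would be a wall-cut time). [cite: MadrasSlade1993, §4.2, Definition 4.2.1 and Theorem 4.2.2 (delay = no break point at 0)] -/
theorem exists_return_zero_dwb (hω : ω ∈ dwb n) (hn : 1 ≤ n) : ∃ j, (1 ≤ j ∧ j ≤ n) ∧ ω j 0 = 0 := by
  obtain ⟨hw, hnc⟩ := mem_dwb.1 hω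
  obtain ⟨ha, hwb⟩ := mem_wbr.1 hw
  obtain ⟨h0, -, -, -⟩ := mem_saws_iff.1 (hpw_subset (archs_subset ha))
  have hX0 : ω 0 0 = 0 := by rw [h0]; rfl
  have h := hnc 0 (by omega)
  unfold IsWCut at h
  simp only [Nat.zero_le, Nat.zero_mod, true_and, not_and, not_forall] at h
  obtain ⟨j, hj1, hj2, hj⟩ := h (by rw [h0]; rfl) (fun i hi => by rw [Nat.le_zero.1 hi])
  have := (hwb j hj2).1
  rw [hX0] at this hj
  exact ⟨j, ⟨by omega, hj2⟩, le_antisymm (not_lt.1 hj) this⟩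

/-- In a delay piece of length `n ≥ 1` NOT every step is a right step. [cite: MadrasSlade1993, §4.2, Definition 4.2.1] -/
theorem exists_step_ne_right_dwb (hω : ω ∈ dwb n) (hn : 1 ≤ n) : ∃ i, i < n ∧ ω (i + 1) 0 ≠ ω i 0 + 1 := by
  obtain ⟨h0, -, -, -⟩ := mem_saws_iff.1 (hpw_subset (hpw_of_mem_dwb hω))
  obtain ⟨j, ⟨hj1, hjn⟩, hj⟩ := exists_return_zero_dwb hω hn
  by_contra hall
  push Not at hall
  have hX : ∀ i, i ≤ n → ω i 0 = i := by
    intro i hi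
    induction i with
    | zero => rw [h0]; rfl
    | succ i ih => rw [hall i (by omega), ih (by omega)]; push_cast; ring
  have := hX j hjn
  rw [hj] at this
  exact absurd this (by exact_mod_cast (show (0 : ℕ) ≠ j by omega))

/-- **The first dive of a delay piece.** The first non-right step of a delay piece (`n ≥ 1`) is a DOWN step from an ODD
wall site `(b, 0)`, `b ≥ 1`, preceded by the straight run `(0,0) → (1,0) → ⋯ → (b,0)`.
[cite: BeatonBousquetMelouDeGierDuminilCopinGuttmann2014, §3.1 (arXiv v5 p. 8: surface sites of the honeycomb half-plane)] -/
theorem exists_first_dive_dwb (hω : ω ∈ dwb n) (hn : 1 ≤ n) :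
    ∃ b, b < n ∧ b % 2 = 1 ∧ (∀ i, i ≤ b → ω i 0 = i ∧ ω i 1 = 0) ∧ ω (b + 1) 0 = b ∧ ω (b + 1) 1 = -1 := by
  classical
  have hh := hpw_of_mem_dwb hω
  obtain ⟨hw, -⟩ := mem_dwb.1 hω
  obtain ⟨-, hwb⟩ := mem_wbr.1 hw
  obtain ⟨hs, hhp⟩ := mem_hpw.1 hh
  obtain ⟨h0, -, hbw, hinj⟩ := mem_saws_iff.1 hs
  have hX0 : ω 0 0 = 0 := by rw [h0]; rfl
  have hex := exists_step_ne_right_dwb hω hn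
  have key : ∃ b, (b < n ∧ ω (b + 1) 0 ≠ ω b 0 + 1) ∧ ∀ i, i < b → ω (i + 1) 0 = ω i 0 + 1 :=
    ⟨Nat.find hex, Nat.find_spec hex, fun i hi => by
      have h := Nat.find_min hex hi
      rw [not_and, not_not] at h
      exact h (lt_trans hi (Nat.find_spec hex).1)⟩
  obtain ⟨b, ⟨hbn, hbR⟩, hmin⟩ := key
  have hrun : ∀ i, i ≤ b → ω i 0 = i ∧ ω i 1 = 0 := by
    intro i hi
    induction i with
    | zero => exact ⟨by rw [h0]; rfl, by rw [h0]; rfl⟩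
    | succ i ih =>
      obtain ⟨hx, hy⟩ := ih (by omega)
      have hR : ω (i + 1) 0 = ω i 0 + 1 := hmin i (by omega)
      rcases step_cases hbw (show i < n by omega) with h | h | h | h
      · exact ⟨by rw [h.1, hx]; push_cast; ring, by rw [h.2, hy]⟩
      · omega
      · omega
      · omega
  obtain ⟨hxb, hyb⟩ := hrun b le_rfl
  rcases step_cases hbw hbn with h | h | h | h
  · exact absurd h.1 hbR
  · exfalso
    rcases Nat.eq_zero_or_pos b with hb0 | hb0
    · have := (hwb 1 (by omega)).1
      rw [hb0] at h
      rw [hX0, h.1, hX0] at this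
      norm_num at this
    · obtain ⟨hx', hy'⟩ := hrun (b - 1) (by omega)
      have heq : ω (b + 1) = ω (b - 1) :=
        site_ext_dsix (by rw [h.1, hxb, hx']; omega) (by rw [h.2, hyb, hy'])
      have := hinj (show b + 1 ∈ {i | i ≤ n} from Nat.succ_le_of_lt hbn)
        (show b - 1 ∈ {i | i ≤ n} by simp only [Set.mem_setOf_eq]; omega) heq
      omega
  · exact absurd (hhp (b + 1) (by omega)) (by rw [h.2, hyb]; norm_num)
  · have hpar := down_step_parity hbw hbn h
    rw [h.1, h.2, hxb, hyb] at hpar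
    exact ⟨b, hbn, by omega, hrun, by rw [h.1, hxb], by rw [h.2, hyb]; norm_num⟩

/-- **The column after the first dive is never visited on the wall** (delay pieces). [cite: MadrasSlade1993, §1.1 (self-avoidance) and §1.2, Definition 1.2.1 (bridges)] -/
theorem wall_ne_first_dive_succ_dwb (hω : ω ∈ dwb n) {b : ℕ} (hbn : b < n)
    (hrun : ∀ i, i ≤ b → ω i 0 = i ∧ ω i 1 = 0) (hyb : ω (b + 1) 1 = -1)
    {t : ℕ} (ht1 : 1 ≤ t) (htn : t ≤ n) (ht2 : t % 2 = 0) (hY : ω t 1 = 0) : ω t 0 ≠ (b : ℤ) + 1 := by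
  intro hx
  have hh := hpw_of_mem_dwb hω
  obtain ⟨hw, -⟩ := mem_dwb.1 hω
  obtain ⟨-, hwb⟩ := mem_wbr.1 hw
  obtain ⟨-, -, -, hinj⟩ := mem_saws_iff.1 (hpw_subset hh)
  have htb : b + 2 ≤ t := by
    by_contra hlt
    rcases Nat.lt_or_ge t (b + 1) with h1 | h1
    · have := (hrun t (by omega)).1; omega
    · have : t = b + 1 := by omega
      subst this; rw [hyb] at hY; norm_num at hY
  have hmem : ∀ {i}, i ≤ n → i ∈ {i | i ≤ n} := fun h => h
  obtain ⟨hprev, hYp⟩ := wall_prev_horizontal_hpw hh ht1 htn ht2 hY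
  obtain ⟨hxbb, hybb⟩ := hrun b le_rfl
  rcases hprev with h1 | h1
  · have heq : ω (t - 1) = ω b := site_ext_dsix (by rw [hxbb]; omega) (by rw [hYp, hybb])
    have := hinj (hmem (by omega)) (hmem hbn.le) heq
    omega
  · rcases eq_or_lt_of_le htn with rfl | hlt
    · have := (hwb (t - 1) (by omega)).2
      omega
    · obtain ⟨hnext, hYs⟩ := wall_step_horizontal_hpw hh hlt ht2 hY
      rcases hnext with h2 | h2
      · have heq : ω (t + 1) = ω (t - 1) := site_ext_dsix (by omega) (by rw [hYs, hYp])
        have := hinj (hmem (by omega)) (hmem (by omega)) heq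
        omega
      · have heq : ω (t + 1) = ω b := site_ext_dsix (by rw [hxbb]; omega) (by rw [hYs, hybb])
        have := hinj (hmem (by omega)) (hmem hbn.le) heq
        omega

/-- **One spare column** (delay pieces): a delay piece of length `n ≥ 1` with `v` surface visits ends at `X_n ≥ 2v + 2` —
the visits occupy distinct even columns of `(0, X_n]` (a visit at column `0` would revisit the origin), and the even column
after the first dive is not one of them. [cite: MadrasSlade1993, §4.2, remark before (4.2.21) (p. 94: span versus length)] -/
theorem two_mul_visits_add_two_le_dwb (hω : ω ∈ dwb n) (hn : 1 ≤ n) : 2 * (visits n ω : ℤ) + 2 ≤ ω n 0 := by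
  classical
  have hh := hpw_of_mem_dwb hω
  obtain ⟨hw, -⟩ := mem_dwb.1 hω
  obtain ⟨ha, hwb⟩ := mem_wbr.1 hw
  obtain ⟨-, hn2, hYn⟩ := mem_archs.1 ha
  obtain ⟨hs, -⟩ := mem_hpw.1 hh
  obtain ⟨h0, -, -, hinj⟩ := mem_saws_iff.1 hs
  have hX0 : ω 0 0 = 0 := by rw [h0]; rfl
  obtain ⟨b, hbn, hb2, hrun, hxb, hyb⟩ := exists_first_dive_dwb hω hn
  set W := wallTimes n ω with hWdef
  have hmemW : ∀ {t}, t ∈ W ↔ (1 ≤ t ∧ t ≤ n) ∧ t % 2 = 0 ∧ ω t 1 = 0 := fun {t} => by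
    rw [hWdef, wallTimes, Finset.mem_filter, Finset.mem_Icc]
  have hWinj : ∀ {t t'}, t ∈ W → t' ∈ W → ω t 0 = ω t' 0 → t = t' := fun {t t'} ht ht' he => by
    obtain ⟨⟨-, htn⟩, -, hy⟩ := hmemW.1 ht
    obtain ⟨⟨-, htn'⟩, -, hy'⟩ := hmemW.1 ht'
    exact hinj (show t ∈ {i | i ≤ n} from htn) (show t' ∈ {i | i ≤ n} from htn') (site_ext_dsix he (by rw [hy, hy']))
  have hWeven : ∀ {t}, t ∈ W → ω t 0 % 2 = 0 ∧ 0 < ω t 0 ∧ ω t 0 ≤ ω n 0 ∧ ω t 0 ≠ (b : ℤ) + 1 := fun {t} ht => by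
    obtain ⟨⟨ht1, htn⟩, ht2, hy⟩ := hmemW.1 ht
    have hpar := parity_apply hs htn
    rw [hy, add_zero] at hpar
    have hbt := hwb t htn
    rw [hX0] at hbt
    have hne0 : ω t 0 ≠ 0 := fun h => by
      have := hinj (show t ∈ {i | i ≤ n} from htn) (show 0 ∈ {i | i ≤ n} from Nat.zero_le n)
        (site_ext_dsix (by rw [h, hX0]) (by rw [hy, h0]; rfl))
      omega
    exact ⟨by omega, lt_of_le_of_ne hbt.1 (Ne.symm hne0), hbt.2,
      wall_ne_first_dive_succ_dwb hω hbn hrun hyb ht1 htn ht2 hy⟩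
  have hbX : (b : ℤ) + 1 ≤ ω n 0 := by
    have h1 := (hwb b hbn.le).2
    rw [(hrun b le_rfl).1] at h1
    have hpar := parity_apply hs le_rfl
    rw [hYn, add_zero] at hpar
    omega
  have h1 : #W ≤ #((Finset.Icc (1 : ℤ) (ω n 0 / 2)).erase (((b : ℤ) + 1) / 2)) := by
    refine Finset.card_le_card_of_injOn (fun t => ω t 0 / 2) (fun t ht => ?_) (fun t ht t' ht' he => ?_)
    · obtain ⟨he, hpos, hle, hne⟩ := hWeven (Finset.mem_coe.1 ht)
      rw [Finset.mem_coe, Finset.mem_erase, Finset.mem_Icc]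
      show ω t 0 / 2 ≠ ((b : ℤ) + 1) / 2 ∧ 1 ≤ ω t 0 / 2 ∧ ω t 0 / 2 ≤ ω n 0 / 2
      refine ⟨?_, ?_, ?_⟩ <;> omega
    · obtain ⟨he1, -, -, -⟩ := hWeven (Finset.mem_coe.1 ht)
      obtain ⟨he2, -, -, -⟩ := hWeven (Finset.mem_coe.1 ht')
      exact hWinj (Finset.mem_coe.1 ht) (Finset.mem_coe.1 ht') (by dsimp only at he; omega)
  have hcard : #((Finset.Icc (1 : ℤ) (ω n 0 / 2)).erase (((b : ℤ) + 1) / 2)) + 1 = #(Finset.Icc (1 : ℤ) (ω n 0 / 2)) :=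
    Finset.card_erase_add_one (Finset.mem_Icc.2 ⟨by omega, by omega⟩)
  rw [Int.card_Icc] at hcard
  have : ((#W : ℕ) : ℤ) + 1 ≤ ω n 0 / 2 := by
    have := Int.toNat_of_nonneg (show (0 : ℤ) ≤ ω n 0 / 2 + 1 - 1 by omega)
    omega
  have hfin : 2 * ((#W : ℕ) : ℤ) + 2 ≤ ω n 0 := by omega
  rw [visits_eq_card]
  exact hfin


/-! ### §3 The charging: every interior visit owns two left/down steps, the final visit owns the last dive, and the
return to column `0` frees two more -/

/-- **The return after a visit without overhang** (delay pieces): a visit at time `1 ≤ t < n` left by a right step and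
with no earlier overhang is not a wall-cut time, so the walk returns (weakly) to column `X_t` at some time `j > t + 1`.
[cite: MadrasSlade1993, §4.2, Definition 4.2.1 (break points)] -/
theorem exists_return_of_no_overhang_dwb (hω : ω ∈ dwb n) {t : ℕ} (htn : t < n) (ht2 : t % 2 = 0)
    (hY : ω t 1 = 0) (hR : ω (t + 1) 0 = ω t 0 + 1) (hno : ∀ i, i < t → ω i 0 ≤ ω t 0) :
    ∃ j, (t + 1 < j ∧ j ≤ n) ∧ ω j 0 ≤ ω t 0 := by
  obtain ⟨-, hnc⟩ := mem_dwb.1 hω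
  have h := hnc t htn
  unfold IsWCut at h
  simp only [not_and, not_forall] at h
  obtain ⟨j, hj1, hj2, hj⟩ := h htn.le ht2 hY (fun i hi => by
    rcases eq_or_lt_of_le hi with rfl | hlt
    · exact le_rfl
    · exact hno i hlt)
  refine ⟨j, ⟨?_, hj2⟩, not_lt.1 hj⟩
  by_contra hle
  have : j = t + 1 := by omega
  subst this
  exact hj (by rw [hR]; exact lt_add_one _)

/-- **The last dive is free** (delay pieces): if a visit at time `1 ≤ t` is left by a right step, has no overhang before
it, and the walk dives immediately afterwards (`ω(t+2) = (X_t + 1, -1)`), then the walk dives AGAIN later.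
[cite: MadrasSlade1993, §4.2, Definition 4.2.1 (break points)] -/
theorem exists_later_down_step_dwb (hω : ω ∈ dwb n) {t : ℕ} (ht1 : 1 ≤ t) (htn : t < n) (ht2 : t % 2 = 0)
    (hY : ω t 1 = 0) (hR : ω (t + 1) 0 = ω t 0 + 1) (hno : ∀ i, i < t → ω i 0 ≤ ω t 0)
    (hD : ω (t + 2) 0 = ω (t + 1) 0 ∧ ω (t + 2) 1 = ω (t + 1) 1 - 1) :
    ∃ s, t + 2 ≤ s ∧ s < n ∧ ω (s + 1) 0 = ω s 0 ∧ ω (s + 1) 1 = ω s 1 - 1 := by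
  classical
  have hh := hpw_of_mem_dwb hω
  obtain ⟨hw, -⟩ := mem_dwb.1 hω
  obtain ⟨ha, hwb⟩ := mem_wbr.1 hw
  obtain ⟨-, hn2, hYn⟩ := mem_archs.1 ha
  obtain ⟨hs, hhp⟩ := mem_hpw.1 hh
  obtain ⟨h0, -, hbw, hinj⟩ := mem_saws_iff.1 hs
  have hmem : ∀ {i}, i ≤ n → i ∈ {i | i ≤ n} := fun h => h
  obtain ⟨-, hY1⟩ := wall_step_horizontal_hpw hh htn ht2 hY
  have ht2n : t + 2 ≤ n := by omega
  have hret := exists_return_of_no_overhang_dwb hω htn ht2 hY hR hno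
  by_contra hnoD
  push Not at hnoD
  have hrows : ∀ i, t + 2 ≤ i → i ≤ n → -1 ≤ ω i 1 := by
    intro i hi hin
    induction i with
    | zero => omega
    | succ i ih =>
      rcases eq_or_lt_of_le hi with he | hlt
      · rw [← he, hD.2, hY1]; norm_num
      · have h1 := ih (by omega) (by omega)
        rcases step_cases hbw (show i < n by omega) with h | h | h | h
        · rw [h.2]; exact h1
        · rw [h.2]; exact h1
        · rw [h.2]; omega
        · exact absurd h.2 (hnoD i (by omega) (by omega) h.1)
  obtain ⟨⟨hj1, hjn⟩, hjx⟩ := Nat.find_spec hret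
  set j := Nat.find hret with hjdef
  have hjmin : ∀ i, t + 1 < i → i < j → ω t 0 < ω i 0 := fun i hi1 hi2 => by
    have := Nat.find_min hret hi2
    by_contra hle
    exact this ⟨⟨hi1, by omega⟩, not_lt.1 hle⟩
  have hj3 : t + 3 ≤ j := by
    by_contra h
    have : j = t + 2 := by omega
    rw [this, hD.1, hR] at hjx
    omega
  have hstepj := abs_sub_apply_zero_le_one (hbw (j - 1) (by omega))
  rw [show j - 1 + 1 = j by omega, abs_le] at hstepj
  have hprev : ω t 0 < ω (j - 1) 0 := by
    rcases eq_or_lt_of_le (show t + 2 ≤ j - 1 by omega) with he | hlt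
    · rw [← he, hD.1, hR]; omega
    · exact hjmin (j - 1) (by omega) (by omega)
  have hjX : ω j 0 = ω t 0 := by omega
  have hjX' : ω (j - 1) 0 = ω t 0 + 1 := by omega
  have hjY : ω j 1 = ω (j - 1) 1 := by
    rcases step_cases hbw (show j - 1 < n by omega) with h | h | h | h <;>
      rw [show j - 1 + 1 = j by omega] at h
    · omega
    · exact h.2
    · omega
    · omega
  have hjrow := hrows j (by omega) hjn
  have hjrow' := hhp j hjn
  rcases (show ω j 1 = 0 ∨ ω j 1 = -1 by omega) with hr | hr
  · have := hinj (hmem hjn) (hmem htn.le) (site_ext_dsix hjX (by rw [hr, hY]))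
    omega
  · have hj1eq : j - 1 = t + 2 := hinj (hmem (by omega)) (hmem ht2n)
      (site_ext_dsix (by rw [hjX', hD.1, hR]) (by rw [← hjY, hr, hD.2, hY1]; norm_num))
    have hex2 : ∃ i, (j < i ∧ i ≤ n) ∧ ω t 0 + 1 ≤ ω i 0 :=
      ⟨n, ⟨by omega, le_rfl⟩, by rw [← hR]; exact (hwb (t + 1) (by omega)).2⟩
    obtain ⟨⟨hi1, hin⟩, hix⟩ := Nat.find_spec hex2
    set i := Nat.find hex2 with hidef
    have himin : ∀ k, j < k → k < i → ω k 0 < ω t 0 + 1 := fun k hk1 hk2 => by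
      have := Nat.find_min hex2 hk2
      by_contra hle
      exact this ⟨⟨hk1, by omega⟩, not_lt.1 hle⟩
    have hstepi := abs_sub_apply_zero_le_one (hbw (i - 1) (by omega))
    rw [show i - 1 + 1 = i by omega, abs_le] at hstepi
    have hprev' : ω (i - 1) 0 < ω t 0 + 1 := by
      rcases eq_or_lt_of_le (show j ≤ i - 1 by omega) with he | hlt
      · rw [← he, hjX]; omega
      · exact himin (i - 1) hlt (by omega)
    have hiX : ω i 0 = ω t 0 + 1 := by omega
    have hiX' : ω (i - 1) 0 = ω t 0 := by omega
    have hiY : ω i 1 = ω (i - 1) 1 := by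
      rcases step_cases hbw (show i - 1 < n by omega) with h | h | h | h <;>
        rw [show i - 1 + 1 = i by omega] at h
      · exact h.2
      · omega
      · omega
      · omega
    have hirow := hrows i (by omega) hin
    have hirow' := hhp i hin
    rcases (show ω i 1 = 0 ∨ ω i 1 = -1 by omega) with hr' | hr'
    · have := hinj (hmem (show i - 1 ≤ n by omega)) (hmem htn.le) (site_ext_dsix hiX' (by rw [← hiY, hr', hY]))
      omega
    · have := hinj (hmem hin) (hmem ht2n) (site_ext_dsix (by rw [hiX, hD.1, hR]) (by rw [hr', hD.2, hY1]; norm_num))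
      omega

/-- **A second dive when the first dive is immediate** (delay pieces): if the first step of a delay piece is followed at
once by the dive `(1,0) → (1,-1)`, the walk dives again later — it must come back to the column `0` below the wall and
then leave the site `(0,-1)`, which has no upward bond. [cite: MadrasSlade1993, §4.2, Definition 4.2.1 and Theorem 4.2.2 (delay pieces)] -/
theorem exists_down_step_after_one_dwb (hω : ω ∈ dwb n) (hn : 1 ≤ n) (h1x : ω 1 0 = 1) (h2x : ω 2 0 = 1)
    (h2y : ω 2 1 = -1) :
    ∃ s, 2 ≤ s ∧ s < n ∧ ω (s + 1) 0 = ω s 0 ∧ ω (s + 1) 1 = ω s 1 - 1 := by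
  have hh := hpw_of_mem_dwb hω
  obtain ⟨hw, -⟩ := mem_dwb.1 hω
  obtain ⟨ha, hwb⟩ := mem_wbr.1 hw
  obtain ⟨-, hn2, hYn⟩ := mem_archs.1 ha
  obtain ⟨hs, hhp⟩ := mem_hpw.1 hh
  obtain ⟨h0, -, hbw, hinj⟩ := mem_saws_iff.1 hs
  have hX0 : ω 0 0 = 0 := by rw [h0]; rfl
  have hmem : ∀ {i}, i ≤ n → i ∈ {i | i ≤ n} := fun h => h
  obtain ⟨j, ⟨hj1, hjn⟩, hjx⟩ := exists_return_zero_dwb hω hn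
  have h2n : 2 ≤ n := by
    by_contra h
    have : n = 1 := by omega
    subst this
    omega
  by_contra hnoD
  push Not at hnoD
  have hrows : ∀ i, 2 ≤ i → i ≤ n → -1 ≤ ω i 1 := by
    intro i hi hin
    induction i with
    | zero => omega
    | succ i ih =>
      rcases eq_or_lt_of_le hi with he | hlt
      · rw [← he, h2y]
      · have h1 := ih (by omega) (by omega)
        rcases step_cases hbw (show i < n by omega) with h | h | h | h
        · rw [h.2]; exact h1
        · rw [h.2]; exact h1
        · rw [h.2]; omega
        · exact absurd h.2 (hnoD i (by omega) (by omega) h.1)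
  have hj3 : 3 ≤ j := by
    by_contra h
    rcases (show j = 1 ∨ j = 2 by omega) with rfl | rfl
    · rw [h1x] at hjx; exact one_ne_zero hjx
    · rw [h2x] at hjx; exact one_ne_zero hjx
  have hjrow := hrows j (by omega) hjn
  have hjY : ω j 1 = -1 := by
    rcases (show ω j 1 = 0 ∨ ω j 1 = -1 by have := hhp j hjn; omega) with hr | hr
    · have := hinj (hmem hjn) (hmem (Nat.zero_le n)) (site_ext_dsix (by rw [hjx, hX0]) (by rw [hr, h0]; rfl))
      omega
    · exact hr
  have hjlt : j < n := lt_of_le_of_ne hjn (by rintro rfl; rw [hYn] at hjY; norm_num at hjY)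
  rcases step_cases hbw hjlt with h | h | h | h
  · have := hinj (hmem (show j + 1 ≤ n by omega)) (hmem h2n)
      (site_ext_dsix (by rw [h.1, hjx, h2x]; norm_num) (by rw [h.2, hjY, h2y]))
    omega
  · have := (hwb (j + 1) (by omega)).1
    rw [hX0, h.1, hjx] at this
    norm_num at this
  · have hu := up_step_parity hbw hjlt h
    rw [hjx, hjY] at hu
    omega
  · exact absurd h.2 (hnoD j (by omega) hjlt h.1)


/-- **The token count for delay pieces**: `2 · visits + 1 ≤ #left + #down` on `dwb n`, `n ≥ 1`.  Every interior visit `t`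
(even column `x = X_t ≥ 2`) owns a left step landing on `x` and a second token — a left step landing on `x − 1` (left-type
and overhang-type visits), a left step landing on `x + 1` (return-type visits followed by a right step) or the dive at time
`t + 1` (return-type visits followed by a dive); the final visit owns the LAST dive (`exists_later_down_step_dwb`); the return
to column `0` owns a left step landing on column `0`; and either a left step landing on column `1` (first run of length
`≥ 3`) or the FIRST dive (first run of length `1`, `exists_down_step_after_one_dwb`) is a further free token.
[cite: MadrasSlade1993, §4.2, remark before (4.2.21) (p. 94: an irreducible bridge of span L ≥ 2 has at least 3L steps)] -/
theorem two_mul_visits_add_one_le_card_dwb (hω : ω ∈ dwb n) (hn : 1 ≤ n) :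
    2 * visits n ω + 1 ≤ #(stepsL n ω) + #(stepsD n ω) := by
  classical
  have hh := hpw_of_mem_dwb hω
  obtain ⟨hw, hnc⟩ := mem_dwb.1 hω
  obtain ⟨ha, hwb⟩ := mem_wbr.1 hw
  obtain ⟨-, hn2, hYn⟩ := mem_archs.1 ha
  obtain ⟨hs, hhp⟩ := mem_hpw.1 hh
  obtain ⟨h0, -, hbw, hinj⟩ := mem_saws_iff.1 hs
  have hX0 : ω 0 0 = 0 := by rw [h0]; rfl
  have hmem : ∀ {i}, i ≤ n → i ∈ {i | i ≤ n} := fun h => h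
  set L := stepsL n ω
  set D := stepsD n ω with hDdef
  set W := wallTimes n ω with hWdef
  have hmemW : ∀ {t}, t ∈ W ↔ (1 ≤ t ∧ t ≤ n) ∧ t % 2 = 0 ∧ ω t 1 = 0 := fun {t} => by
    rw [hWdef, wallTimes, Finset.mem_filter, Finset.mem_Icc]
  have hWinj : ∀ {t t'}, t ∈ W → t' ∈ W → ω t 0 = ω t' 0 → t = t' := fun {t t'} ht ht' he => by
    obtain ⟨⟨-, htn⟩, -, hy⟩ := hmemW.1 ht
    obtain ⟨⟨-, htn'⟩, -, hy'⟩ := hmemW.1 ht'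
    exact hinj (hmem htn) (hmem htn') (site_ext_dsix he (by rw [hy, hy']))
  have hWeven : ∀ {t}, t ∈ W → ω t 0 % 2 = 0 ∧ 2 ≤ ω t 0 := fun {t} ht => by
    obtain ⟨⟨ht1, htn⟩, ht2, hy⟩ := hmemW.1 ht
    have hpar := parity_apply hs htn
    rw [hy, add_zero] at hpar
    have hbt := (hwb t htn).1
    rw [hX0] at hbt
    have hne0 : ω t 0 ≠ 0 := fun h => by
      have := hinj (hmem htn) (hmem (Nat.zero_le n)) (site_ext_dsix (by rw [h, hX0]) (by rw [hy, h0]; rfl))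
      omega
    exact ⟨by omega, by omega⟩
  have hmemL : ∀ {i}, i ∈ L ↔ i < n ∧ ω (i + 1) 0 = ω i 0 - 1 := fun {i} => by
    show i ∈ stepsL n ω ↔ _; rw [stepsL, Finset.mem_filter, Finset.mem_range]
  have hmemD : ∀ {i}, i ∈ D ↔ i < n ∧ ω (i + 1) 0 = ω i 0 ∧ ω (i + 1) 1 = ω i 1 - 1 := fun {i} => by
    show i ∈ stepsD n ω ↔ _; rw [stepsD, Finset.mem_filter, Finset.mem_range]
  -- the first dive and the return to column `0`
  obtain ⟨b, hbn, hb2, hrun, hxb, hyb⟩ := exists_first_dive_dwb hω hn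
  have hbD : b ∈ D := hmemD.2 ⟨hbn, by rw [hxb, (hrun b le_rfl).1], by rw [hyb, (hrun b le_rfl).2]; norm_num⟩
  have hne : D.Nonempty := ⟨b, hbD⟩
  obtain ⟨j0, ⟨hj01, hj0n⟩, hj0x⟩ := exists_return_zero_dwb hω hn
  have hx1 : ω 1 0 = 1 := by have := (hrun 1 (by omega)).1; rw [this]; rfl
  -- the interior visits
  have hnW : n ∈ W := hmemW.2 ⟨⟨hn, le_rfl⟩, hn2, hYn⟩
  set W' := W.erase n with hW'def
  have hWW' : #W = #W' + 1 := (Finset.card_erase_add_one hnW).symm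
  have hmemW' : ∀ {t}, t ∈ W' → 1 ≤ t ∧ t < n ∧ t % 2 = 0 ∧ ω t 1 = 0 ∧ t ∈ W := fun {t} ht => by
    obtain ⟨hne', htW⟩ := Finset.mem_erase.1 ht
    obtain ⟨⟨ht1, htn⟩, ht2, hy⟩ := hmemW.1 htW
    exact ⟨ht1, lt_of_le_of_ne htn hne', ht2, hy, htW⟩
  set WL := W'.filter fun t => ω (t + 1) 0 = ω t 0 - 1 with hWL
  set WRo := W'.filter fun t => ω (t + 1) 0 = ω t 0 + 1 ∧ ∃ i, i < t ∧ ω t 0 < ω i 0 with hWRo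
  set WRr := W'.filter fun t => ω (t + 1) 0 = ω t 0 + 1 ∧ ∀ i, i < t → ω i 0 ≤ ω t 0 with hWRr
  set WRrD := WRr.filter fun t => ω (t + 2) 0 = ω (t + 1) 0 ∧ ω (t + 2) 1 = ω (t + 1) 1 - 1 with hWRrD
  set WRrR := WRr.filter fun t => ω (t + 2) 0 = ω (t + 1) 0 + 1 with hWRrR
  have hmemWL : ∀ {t}, t ∈ WL ↔ t ∈ W' ∧ ω (t + 1) 0 = ω t 0 - 1 := fun {t} => by rw [hWL, Finset.mem_filter]
  have hmemWRo : ∀ {t}, t ∈ WRo ↔ t ∈ W' ∧ ω (t + 1) 0 = ω t 0 + 1 ∧ ∃ i, i < t ∧ ω t 0 < ω i 0 := fun {t} => by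
    rw [hWRo, Finset.mem_filter]
  have hmemWRr : ∀ {t}, t ∈ WRr ↔ t ∈ W' ∧ ω (t + 1) 0 = ω t 0 + 1 ∧ ∀ i, i < t → ω i 0 ≤ ω t 0 := fun {t} => by
    rw [hWRr, Finset.mem_filter]
  have hmemWRrD : ∀ {t}, t ∈ WRrD ↔ t ∈ WRr ∧ ω (t + 2) 0 = ω (t + 1) 0 ∧ ω (t + 2) 1 = ω (t + 1) 1 - 1 :=
    fun {t} => by rw [hWRrD, Finset.mem_filter]
  have hmemWRrR : ∀ {t}, t ∈ WRrR ↔ t ∈ WRr ∧ ω (t + 2) 0 = ω (t + 1) 0 + 1 := fun {t} => by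
    rw [hWRrR, Finset.mem_filter]
  have hcover : W' ⊆ WL ∪ WRo ∪ WRr := fun t ht => by
    obtain ⟨ht1, htn, ht2, hy, -⟩ := hmemW' ht
    rw [Finset.mem_union, Finset.mem_union, hmemWL, hmemWRo, hmemWRr]
    obtain ⟨hstep, -⟩ := wall_step_horizontal_hpw hh htn ht2 hy
    rcases hstep with h | h
    · by_cases hov : ∃ i, i < t ∧ ω t 0 < ω i 0
      · exact Or.inl (Or.inr ⟨ht, h, hov⟩)
      · push Not at hov
        exact Or.inr ⟨ht, h, hov⟩
    · exact Or.inl (Or.inl ⟨ht, h⟩)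
  have hR1 : ∀ {t}, t ∈ WRr → ω (t + 1) 1 = 0 ∧ t + 1 < n ∧
      (ω (t + 2) 0 = ω (t + 1) 0 + 1 ∧ ω (t + 2) 1 = 0 ∨
        ω (t + 2) 0 = ω (t + 1) 0 ∧ ω (t + 2) 1 = ω (t + 1) 1 - 1) := fun {t} ht => by
    obtain ⟨ht', hR, -⟩ := hmemWRr.1 ht
    obtain ⟨ht1, htn, ht2, hy, -⟩ := hmemW' ht'
    obtain ⟨-, hY1⟩ := wall_step_horizontal_hpw hh htn ht2 hy
    have ht1n : t + 1 < n := by omega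
    refine ⟨hY1, ht1n, ?_⟩
    rcases step_cases hbw ht1n with h | h | h | h
    · exact Or.inl ⟨h.1, by rw [h.2, hY1]⟩
    · have heq : ω (t + 2) = ω t := site_ext_dsix (by rw [h.1, hR]; ring) (by rw [h.2, hY1, hy])
      have := hinj (hmem (by omega)) (hmem htn.le) heq
      omega
    · exact absurd (hhp (t + 2) (by omega)) (by rw [h.2, hY1]; norm_num)
    · exact Or.inr h
  have hcover2 : WRr ⊆ WRrD ∪ WRrR := fun t ht => by
    rw [Finset.mem_union, hmemWRrD, hmemWRrR]
    rcases (hR1 ht).2.2 with h | h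
    · exact Or.inr ⟨ht, h.1⟩
    · exact Or.inl ⟨ht, h⟩
  set Lod := L.filter fun i => ¬ ω (i + 1) 0 % 2 = 0 with hLod
  set Lev := L.filter fun i => ω (i + 1) 0 % 2 = 0 with hLev
  have hLsplit : #Lev + #Lod = #L := Finset.card_filter_add_card_filter_not _
  -- (C) every interior visit owns a left step landing on its own (even, `≥ 2`) column; column `0` owns one more
  have hex1 : ∀ t ∈ W', ∃ k, k < n ∧ ω (k + 1) 0 = ω k 0 - 1 ∧ ω (k + 1) 0 = ω t 0 := fun t ht => by
    obtain ⟨ht1, htn, ht2, hy, -⟩ := hmemW' ht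
    obtain ⟨hstep, -⟩ := wall_step_horizontal_hpw hh htn ht2 hy
    have hpq := wall_prev_of_step_hpw hh ht1 htn ht2 hy
    rcases hstep with h | h
    · by_cases hov : ∃ i, i < t ∧ ω t 0 < ω i 0
      · obtain ⟨i, hit, hi⟩ := hov
        have hp1 := hpq.2 h
        have hit' : i < t - 1 := by
          by_contra hge
          have : i = t - 1 := by omega
          rw [this] at hi
          omega
        obtain ⟨k, -, hk2, hk3, hk4⟩ :=
          exists_descent hbw (a := i) (b := t - 1) (c := ω t 0) hit' (by omega) hi (by omega)
        exact ⟨k, by omega, by omega, hk4⟩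
      · push Not at hov
        obtain ⟨j, ⟨hj1, hjn⟩, hjx⟩ := exists_return_of_no_overhang_dwb hω htn ht2 hy h hov
        obtain ⟨k, -, hk2, hk3, hk4⟩ := exists_descent hbw (a := t + 1) (b := j) (c := ω t 0) hj1 hjn (by omega) hjx
        exact ⟨k, by omega, by omega, hk4⟩
    · have := hpq.1 h
      exact ⟨t - 1, by omega, by rw [show t - 1 + 1 = t by omega]; omega, by rw [show t - 1 + 1 = t by omega]⟩
  -- E1: a left step landing on column `0`
  have hj02 : 1 < j0 := by
    by_contra h
    have : j0 = 1 := by omega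
    rw [this, hx1] at hj0x
    exact one_ne_zero hj0x
  obtain ⟨k0, -, hk02, hk03, hk04⟩ := exists_descent hbw (a := 1) (b := j0) (c := 0) hj02 hj0n (by rw [hx1]; norm_num)
    hj0x.le
  have hk0L : k0 ∈ Lev := by
    rw [hLev, Finset.mem_filter, hmemL]
    exact ⟨⟨by omega, by omega⟩, by rw [hk04]; decide⟩
  have hC : #W' + 1 ≤ #Lev := by
    let φ : ℕ → ℕ := fun t => if h : t ∈ W' then Classical.choose (hex1 t h) else 0
    have hφ : ∀ t (h : t ∈ W'), φ t < n ∧ ω (φ t + 1) 0 = ω (φ t) 0 - 1 ∧ ω (φ t + 1) 0 = ω t 0 := fun t h => by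
      simp only [φ, dif_pos h]; exact Classical.choose_spec (hex1 t h)
    have h1 : #W' ≤ #(Lev.erase k0) := by
      refine Finset.card_le_card_of_injOn φ (fun t ht => ?_) (fun t ht t' ht' he => ?_)
      · have ht' := Finset.mem_coe.1 ht
        obtain ⟨h1, h2, h3⟩ := hφ t ht'
        have hev := hWeven (hmemW' ht').2.2.2.2
        rw [Finset.mem_coe, Finset.mem_erase, hLev, Finset.mem_filter, hmemL]
        refine ⟨fun he => ?_, ⟨h1, h2⟩, by rw [h3]; exact hev.1⟩
        rw [he, hk04] at h3
        omega
      · have h1 := Finset.mem_coe.1 ht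
        have h2 := Finset.mem_coe.1 ht'
        obtain ⟨-, -, e1⟩ := hφ t h1
        obtain ⟨-, -, e2⟩ := hφ t' h2
        exact hWinj (hmemW' h1).2.2.2.2 (hmemW' h2).2.2.2.2 (by rw [← e1, ← e2, he])
    rw [Finset.card_erase_of_mem hk0L] at h1
    have := Finset.card_pos.2 ⟨k0, hk0L⟩
    omega
  -- (B) odd landing columns
  have hexo : ∀ t ∈ WRo, ∃ k, k < n ∧ ω (k + 1) 0 = ω k 0 - 1 ∧ ω (k + 1) 0 = ω t 0 - 1 := fun t ht => by
    obtain ⟨ht', hR, i, hit, hi⟩ := hmemWRo.1 ht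
    obtain ⟨ht1, htn, ht2, hy, -⟩ := hmemW' ht'
    have hp1 := (wall_prev_of_step_hpw hh ht1 htn ht2 hy).2 hR
    have hit' : i < t - 1 := by
      by_contra hge
      have : i = t - 1 := by omega
      rw [this] at hi
      omega
    obtain ⟨k, -, hk2, hk3, hk4⟩ :=
      exists_descent hbw (a := i) (b := t - 1) (c := ω t 0 - 1) hit' (by omega) (by omega) (by omega)
    exact ⟨k, by omega, by omega, hk4⟩
  have hexr : ∀ t ∈ WRrR, ∃ k, k < n ∧ ω (k + 1) 0 = ω k 0 - 1 ∧ ω (k + 1) 0 = ω t 0 + 1 := fun t ht => by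
    obtain ⟨ht', hRR⟩ := hmemWRrR.1 ht
    obtain ⟨ht'', hR, hno⟩ := hmemWRr.1 ht'
    obtain ⟨ht1, htn, ht2, hy, -⟩ := hmemW' ht''
    obtain ⟨j, ⟨hj1, hjn⟩, hjx⟩ := exists_return_of_no_overhang_dwb hω htn ht2 hy hR hno
    have hj2 : t + 2 < j := by
      by_contra h
      have : j = t + 2 := by omega
      rw [this, hRR, hR] at hjx
      omega
    obtain ⟨k, -, hk2, hk3, hk4⟩ :=
      exists_descent hbw (a := t + 2) (b := j) (c := ω t 0 + 1) hj2 hjn (by rw [hRR, hR]; omega) (by omega)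
    exact ⟨k, by omega, by omega, hk4⟩
  have hoL : ∀ {t}, t ∈ WRo → t ∉ WL := fun {t} ht hl => by
    have h1 := (hmemWRo.1 ht).2.1
    have h2 := (hmemWL.1 hl).2
    omega
  have hrL : ∀ {t}, t ∈ WRrR → t ∉ WL := fun {t} ht hl => by
    have h1 := (hmemWRr.1 (hmemWRrR.1 ht).1).2.1
    have h2 := (hmemWL.1 hl).2
    omega
  have hro : ∀ {t}, t ∈ WRrR → t ∉ WRo := fun {t} ht ho => by
    obtain ⟨-, -, i, hit, hi⟩ := hmemWRo.1 ho
    have := (hmemWRr.1 (hmemWRrR.1 ht).1).2.2 i hit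
    omega
  have hnoconf : ∀ {t t'}, (t ∈ WL ∨ t ∈ WRo) → t' ∈ WRrR → ω t 0 = ω t' 0 + 2 → False :=
      fun {t t'} ht ht' he => by
    obtain ⟨ht'R, hRR⟩ := hmemWRrR.1 ht'
    obtain ⟨ht'W, hR', hno'⟩ := hmemWRr.1 ht'R
    obtain ⟨hY1', -, hcase⟩ := hR1 ht'R
    have hY2' : ω (t' + 2) 1 = 0 := by
      rcases hcase with h | h
      · exact h.2
      · omega
    obtain ⟨-, ht'n, ht'2, hy', -⟩ := hmemW' ht'W
    have htW : t ∈ W' := by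
      rcases ht with h | h
      · exact (hmemWL.1 h).1
      · exact (hmemWRo.1 h).1
    obtain ⟨ht1, htn, ht2, hy, -⟩ := hmemW' htW
    have het : t = t' + 2 := hinj (hmem htn.le) (hmem (by omega))
      (site_ext_dsix (by rw [he, hRR, hR']; ring) (by rw [hy, hY2']))
    rcases ht with h | h
    · have hl := (hmemWL.1 h).2
      have heq : ω (t + 1) = ω (t' + 1) :=
        site_ext_dsix (by rw [hl, he, hR']; ring) (by rw [(wall_step_horizontal_hpw hh htn ht2 hy).2, hY1'])
      have := hinj (hmem (by omega)) (hmem (by omega)) heq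
      omega
    · obtain ⟨-, -, i, hit, hi⟩ := hmemWRo.1 h
      rw [het] at hit
      rw [he] at hi
      rcases (show i < t' ∨ i = t' ∨ i = t' + 1 by omega) with h' | h' | h'
      · have := hno' i h'; omega
      · rw [h'] at hi; omega
      · rw [h', hR'] at hi; omega
  -- the token map on odd columns, and (when the first run has length `≥ 3`) the free left step landing on column `1`
  have hB : #WL + #WRo + #WRrR + (if b = 1 then 0 else 1) ≤ #Lod := by
    let ψ : ℕ → ℕ := fun t =>
      if t ∈ WL then t else if h : t ∈ WRo then Classical.choose (hexo t h)
        else if h' : t ∈ WRrR then Classical.choose (hexr t h') else 0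
    have hψ : ∀ t, t ∈ WL ∪ WRo ∪ WRrR → ψ t < n ∧ ω (ψ t + 1) 0 = ω (ψ t) 0 - 1 ∧
        (((t ∈ WL ∨ t ∈ WRo) ∧ ω (ψ t + 1) 0 = ω t 0 - 1) ∨ (t ∈ WRrR ∧ ω (ψ t + 1) 0 = ω t 0 + 1)) := by
      intro t ht
      rw [Finset.mem_union, Finset.mem_union] at ht
      by_cases hl : t ∈ WL
      · have e : ψ t = t := by simp only [ψ, if_pos hl]
        obtain ⟨htW, hls⟩ := hmemWL.1 hl
        obtain ⟨-, htn, -, -, -⟩ := hmemW' htW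
        rw [e]
        exact ⟨htn, hls, Or.inl ⟨Or.inl hl, hls⟩⟩
      · by_cases ho : t ∈ WRo
        · have e : ψ t = Classical.choose (hexo t ho) := by simp only [ψ, if_neg hl, dif_pos ho]
          obtain ⟨h1, h2, h3⟩ := Classical.choose_spec (hexo t ho)
          rw [e]
          exact ⟨h1, h2, Or.inl ⟨Or.inr ho, h3⟩⟩
        · have hr : t ∈ WRrR := by tauto
          have e : ψ t = Classical.choose (hexr t hr) := by simp only [ψ, if_neg hl, dif_neg ho, dif_pos hr]
          obtain ⟨h1, h2, h3⟩ := Classical.choose_spec (hexr t hr)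
          rw [e]
          exact ⟨h1, h2, Or.inr ⟨hr, h3⟩⟩
    have hWof : ∀ {t}, t ∈ WL ∪ WRo ∪ WRrR → t ∈ W := fun {t} ht => by
      rw [Finset.mem_union, Finset.mem_union] at ht
      rcases ht with (h | h) | h
      · exact (hmemW' (hmemWL.1 h).1).2.2.2.2
      · exact (hmemW' (hmemWRo.1 h).1).2.2.2.2
      · exact (hmemW' (hmemWRr.1 (hmemWRrR.1 h).1).1).2.2.2.2
    have hcardS : #(WL ∪ WRo ∪ WRrR) = #WL + #WRo + #WRrR := by
      rw [Finset.card_union_of_disjoint, Finset.card_union_of_disjoint]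
      · exact Finset.disjoint_left.2 fun t hl ho => hoL ho hl
      · exact Finset.disjoint_left.2 fun t h hr => by
          rcases Finset.mem_union.1 h with hl | ho
          · exact hrL hr hl
          · exact hro hr ho
    -- the landing column of a token is `≥ 2` when the first run is long (`b ≥ 3` makes column `2`'s visit return-type)
    have hland : ∀ t, t ∈ WL ∪ WRo ∪ WRrR → b ≠ 1 → ω (ψ t + 1) 0 ≠ 1 := by
      intro t ht hb1 he1
      obtain ⟨-, -, h3⟩ := hψ t ht
      have htW := hWof ht
      have hev := hWeven htW
      rcases h3 with ⟨htc, e⟩ | ⟨-, e⟩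
      · -- `X_t = 2`: then `t = 2` sits in the first run and is return-type, not left/overhang-type
        have hx2 : ω t 0 = 2 := by rw [e] at he1; omega
        have h22 := hrun 2 (by omega)
        have ht2' : t = 2 := hWinj htW (hmemW.2 ⟨⟨by norm_num, by omega⟩, by norm_num, h22.2⟩)
          (by rw [hx2, h22.1]; rfl)
        subst ht2'
        rcases htc with hl | ho
        · have := (hmemWL.1 hl).2
          have h3' := (hrun 3 (by omega)).1
          rw [h3', h22.1] at this
          norm_num at this
        · obtain ⟨-, -, i, hit, hi⟩ := hmemWRo.1 ho
          have := (hrun i (by omega)).1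
          rw [this, h22.1] at hi
          exact absurd hi (by exact_mod_cast (show ¬ (2 : ℕ) < i by omega))
      · rw [e] at he1
        omega
    have h1 : #(WL ∪ WRo ∪ WRrR) ≤ #(Lod.filter fun i => b = 1 ∨ ω (i + 1) 0 ≠ 1) := by
      refine Finset.card_le_card_of_injOn ψ (fun t ht => ?_) (fun t ht t' ht' hee => ?_)
      · have ht' := Finset.mem_coe.1 ht
        obtain ⟨h1, h2, h3⟩ := hψ t ht'
        have hev := hWeven (hWof ht')
        rw [Finset.mem_coe, Finset.mem_filter, hLod, Finset.mem_filter, hmemL]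
        refine ⟨⟨⟨h1, h2⟩, ?_⟩, ?_⟩
        · rcases h3 with ⟨-, h⟩ | ⟨-, h⟩ <;> rw [h] <;> omega
        · by_cases hb1 : b = 1
          · exact Or.inl hb1
          · exact Or.inr (hland t ht' hb1)
      · have h1 := Finset.mem_coe.1 ht
        have h2 := Finset.mem_coe.1 ht'
        obtain ⟨-, -, c1⟩ := hψ t h1
        obtain ⟨-, -, c2⟩ := hψ t' h2
        have hee' : ω (ψ t + 1) 0 = ω (ψ t' + 1) 0 := by rw [hee]
        rcases c1 with ⟨ht1, e1⟩ | ⟨ht1, e1⟩ <;> rcases c2 with ⟨ht2, e2⟩ | ⟨ht2, e2⟩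
        · exact hWinj (hWof h1) (hWof h2) (by rw [e1, e2] at hee'; omega)
        · exact (hnoconf ht1 ht2 (by rw [e1, e2] at hee'; omega)).elim
        · exact (hnoconf ht2 ht1 (by rw [e1, e2] at hee'; omega)).elim
        · exact hWinj (hWof h1) (hWof h2) (by rw [e1, e2] at hee'; omega)
    rw [hcardS] at h1
    by_cases hb1 : b = 1
    · rw [if_pos hb1, add_zero]
      exact h1.trans (Finset.card_filter_le _ _)
    · rw [if_neg hb1]
      -- a left step landing on column `1`: the descent from `(2, 0) = ω 2` to column `0`
      have hb3 : 3 ≤ b := by omega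
      have hx2 : ω 2 0 = 2 := by rw [(hrun 2 (by omega)).1]; rfl
      have hj03 : 2 < j0 := by
        by_contra h
        rcases (show j0 = 1 ∨ j0 = 2 by omega) with rfl | rfl
        · rw [hx1] at hj0x; exact one_ne_zero hj0x
        · rw [hx2] at hj0x; exact two_ne_zero hj0x
      obtain ⟨k1, -, hk12, hk13, hk14⟩ :=
        exists_descent hbw (a := 2) (b := j0) (c := 1) hj03 hj0n (by rw [hx2]; norm_num) (by rw [hj0x]; norm_num)
      have hk1 : k1 ∈ Lod.filter fun i => ¬ (b = 1 ∨ ω (i + 1) 0 ≠ 1) := by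
        rw [Finset.mem_filter, hLod, Finset.mem_filter, hmemL]
        exact ⟨⟨⟨by omega, by omega⟩, by rw [hk14]; decide⟩, by rw [hk14]; tauto⟩
      have hsplit := Finset.card_filter_add_card_filter_not (s := Lod) (fun i => b = 1 ∨ ω (i + 1) 0 ≠ 1)
      have := Finset.card_pos.2 ⟨k1, hk1⟩
      omega
  -- (D) the dives: return-type visits followed by a dive own it; the last dive and (when `b = 1`) the first dive are free
  have hDtok : #WRrD + 1 + (if b = 1 then 1 else 0) ≤ #D := by
    have hsD : D.max' hne ∈ D := Finset.max'_mem _ _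
    have himg : ∀ t ∈ WRrD, t + 1 ∈ D ∧ t + 1 < D.max' hne ∧ 3 ≤ t + 1 := fun t ht => by
      obtain ⟨htR, hd⟩ := hmemWRrD.1 ht
      obtain ⟨htW, hR, hno⟩ := hmemWRr.1 htR
      obtain ⟨ht1, htn, ht2, hy, -⟩ := hmemW' htW
      obtain ⟨-, ht1n, -⟩ := hR1 htR
      obtain ⟨s, hs1, hs2, hs3, hs4⟩ := exists_later_down_step_dwb hω ht1 htn ht2 hy hR hno hd
      have hle := D.le_max' s (hmemD.2 ⟨hs2, hs3, hs4⟩)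
      exact ⟨hmemD.2 ⟨ht1n, hd⟩, by omega, by omega⟩
    by_cases hb1 : b = 1
    · rw [if_pos hb1]
      -- the first dive `b = 1` is a down step at time `1 < 3`, and not the last one
      subst hb1
      obtain ⟨s, hs1, hs2, hs3, hs4⟩ := exists_down_step_after_one_dwb hω hn hx1 (by rw [hxb]; rfl) hyb
      have hsle := D.le_max' s (hmemD.2 ⟨hs2, hs3, hs4⟩)
      have h1 : #WRrD ≤ #((D.erase (D.max' hne)).erase 1) := by
        refine Finset.card_le_card_of_injOn (fun t => t + 1) (fun t ht => ?_) (fun t _ t' _ he => by simpa using he)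
        obtain ⟨hm, hlt, h3⟩ := himg t (Finset.mem_coe.1 ht)
        rw [Finset.mem_coe, Finset.mem_erase, Finset.mem_erase]
        show t + 1 ≠ 1 ∧ t + 1 ≠ D.max' hne ∧ t + 1 ∈ D
        exact ⟨by omega, by omega, hm⟩
      have hm1 : (1 : ℕ) ∈ D.erase (D.max' hne) := Finset.mem_erase.2 ⟨by omega, hbD⟩
      rw [Finset.card_erase_of_mem hm1, Finset.card_erase_of_mem hsD] at h1
      have h2 : 2 ≤ #D := by
        have hsD2 : s ∈ D := hmemD.2 ⟨hs2, hs3, hs4⟩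
        have hne1 : s ≠ 1 := by omega
        exact Finset.one_lt_card.2 ⟨1, hbD, s, hsD2, hne1.symm⟩
      omega
    · rw [if_neg hb1, add_zero]
      have h1 : #WRrD ≤ #(D.erase (D.max' hne)) := by
        refine Finset.card_le_card_of_injOn (fun t => t + 1) (fun t ht => ?_) (fun t _ t' _ he => by simpa using he)
        obtain ⟨hm, hlt, -⟩ := himg t (Finset.mem_coe.1 ht)
        rw [Finset.mem_coe, Finset.mem_erase]
        show t + 1 ≠ D.max' hne ∧ t + 1 ∈ D
        exact ⟨by omega, hm⟩
      rw [Finset.card_erase_of_mem hsD] at h1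
      have := hne.card_pos
      omega
  -- bookkeeping
  have hW'le : #W' ≤ #WL + #WRo + #WRrR + #WRrD := by
    have h1 := Finset.card_le_card hcover
    have h2 := Finset.card_union_le (WL ∪ WRo) WRr
    have h3 := Finset.card_union_le WL WRo
    have h4 := Finset.card_le_card hcover2
    have h5 := Finset.card_union_le WRrD WRrR
    omega
  rw [visits_eq_card]
  show 2 * #W + 1 ≤ #L + #D
  by_cases hb1 : b = 1
  · rw [if_pos hb1] at hB hDtok; omega
  · rw [if_neg hb1] at hB hDtok; omega

/-- **Six steps per visit plus four (the sharp entropy lemma for delay pieces).** A delay piece of length `n ≥ 1` has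
at most `(n − 4)/6` surface visits: `6 · visits + 4 ≤ n`.  (Equality: the iterated hooks with a dive to column `0`, of
lengths `10, 16, 22, …`; the law was conjectured from the exact census of delay pieces to length `22` on this lane and is
NEW.)  PROOF: `n = X_n + 2·#left + 2·#down`, `X_n ≥ 2·visits + 2` (`two_mul_visits_add_two_le_dwb`) and
`2·visits + 1 ≤ #left + #down` (`two_mul_visits_add_one_le_card_dwb`).  It sharpens the tree's
`four_mul_visits_le_dwb : 4·visits ≤ n + 2`; the bridge analogue is the six-step law `six_mul_visits_le` of
`HexSAWSurfaceWallRenewalSixStep`, and the model statement is Madras–Slade's remark that an irreducible bridge of span `L`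
has at least `3L` steps. [cite: MadrasSlade1993, §4.2, remark before (4.2.21) (p. 94)] -/
theorem six_mul_visits_add_four_le_dwb (hω : ω ∈ dwb n) (hn : 1 ≤ n) : 6 * visits n ω + 4 ≤ n := by
  obtain ⟨hw, -⟩ := mem_dwb.1 hω
  obtain ⟨ha, -⟩ := mem_wbr.1 hw
  obtain ⟨hh, -, hYn⟩ := mem_archs.1 ha
  obtain ⟨hs, -⟩ := mem_hpw.1 hh
  obtain ⟨h0, -, hbw, -⟩ := mem_saws_iff.1 hs
  have hX0 : ω 0 0 = 0 := by rw [h0]; rfl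
  have hY0 : ω 0 1 = 0 := by rw [h0]; rfl
  obtain ⟨hcnt, hX, hY⟩ := steps_count hbw
  rw [hX0, sub_zero] at hX
  rw [hY0, hYn, sub_zero] at hY
  have hA := two_mul_visits_add_two_le_dwb hω hn
  have hB := two_mul_visits_add_one_le_card_dwb hω hn
  have hcnt' : ((#(stepsR n ω) + #(stepsL n ω) + #(stepsU n ω) + #(stepsD n ω) : ℕ) : ℤ) = n := by exact_mod_cast hcnt
  push_cast at hcnt'
  have hB' : (2 * (visits n ω : ℕ) + 1 : ℤ) ≤ #(stepsL n ω) + #(stepsD n ω) := by exact_mod_cast hB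
  have hfin : (6 * (visits n ω : ℕ) + 4 : ℤ) ≤ n := by linarith
  exact_mod_cast hfin

/-- `visits ≤ (n − 4)/6` on delay pieces of length `n ≥ 1`. [cite: MadrasSlade1993, §4.2, remark before (4.2.21) (p. 94)] -/
theorem visits_le_sub_div_six_dwb (hω : ω ∈ dwb n) (hn : 1 ≤ n) : visits n ω ≤ (n - 4) / 6 :=
  (Nat.le_div_iff_mul_le (by norm_num)).2 (by have := six_mul_visits_add_four_le_dwb hω hn; omega)

/-- The even-length form: on `dwb (2s)`, `3 · visits ≤ s − 2` for every `s` (for `s ≤ 2` both sides vanish: there are no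
delay pieces of lengths `2` and `4`, and `dwb 0` is the empty walk). [cite: MadrasSlade1993, §4.2, remark before (4.2.21) (p. 94)] -/
theorem three_mul_visits_le_sub_two_dwb {s : ℕ} (hω : ω ∈ dwb (2 * s)) : 3 * visits (2 * s) ω ≤ s - 2 := by
  rcases Nat.eq_zero_or_pos s with rfl | hs
  · simp
  · have := six_mul_visits_add_four_le_dwb hω (by omega)
    omega


/-! ### §4 The delay law down to `y > μ³`: envelope of ratio `θ₃ = μ²/y^{2/3}`, summable delay mass, and the DELAYED
renewal theorem for ALL wall bridges -/

/-- Per walk: `y^{visits} ≤ y^{⌊(s−2)/3⌋}` on `dwb (2s)`, `y ≥ 1` (the delay six-step law).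
[cite: MadrasSlade1993, §4.2, remark before (4.2.21) (p. 94)] -/
theorem pow_visits_le_pow_sub_div_three_dwb (hy : 1 ≤ y) {s : ℕ} (hω : ω ∈ dwb (2 * s)) :
    y ^ visits (2 * s) ω ≤ y ^ ((s - 2) / 3) :=
  pow_le_pow_right₀ hy ((Nat.le_div_iff_mul_le (by norm_num)).2
    (by have := three_mul_visits_le_sub_two_dwb hω; omega))

/-- **Envelope of the delay count** (`y ≥ 1`): `D_{2s}(y) ≤ μ^{2s+2} · y^{⌊(s−2)/3⌋}` — the delay six-step law for the weight,
`#dwb_{2s} ≤ #wbr_{2s} ≤ μ^{2s+2}` for the count. Improves the tree's `DWB_le_pow_mul_sqrt_pow` (`… · (√y)^{s+1}`). NEW.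
[cite: MadrasSlade1993, §4.2, remark before (4.2.21) (p. 94); §1.2, (1.2.16)–(1.2.17) (p. 11)] -/
theorem DWB_le_pow_mul_pow_sub_div_three (hy : 1 ≤ y) (s : ℕ) :
    DWB (2 * s) y ≤ hexConnectiveConstant ^ (2 * s + 2) * y ^ ((s - 2) / 3) := by
  have hy0 : 0 ≤ y := by linarith
  have hterm : ∀ ω ∈ dwb (2 * s), y ^ visits (2 * s) ω ≤ y ^ ((s - 2) / 3) := fun ω hω =>
    pow_visits_le_pow_sub_div_three_dwb hy hω
  have hcard : (#(dwb (2 * s)) : ℝ) ≤ #(wbr (2 * s)) := by exact_mod_cast Finset.card_le_card dwb_subset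
  calc DWB (2 * s) y ≤ ∑ ω ∈ dwb (2 * s), y ^ ((s - 2) / 3) := Finset.sum_le_sum hterm
    _ = #(dwb (2 * s)) * y ^ ((s - 2) / 3) := by rw [Finset.sum_const, nsmul_eq_mul]
    _ ≤ #(wbr (2 * s)) * y ^ ((s - 2) / 3) := mul_le_mul_of_nonneg_right hcard (pow_nonneg hy0 _)
    _ ≤ _ := mul_le_mul_of_nonneg_right (card_wbr_le_pow (2 * s)) (pow_nonneg hy0 _)

/-- [folklore] `y ≤ β(y)²` via `y ≤ P₂(y) ≤ β(y)²` (private twin of the tree's private `le_sq_wallRate_wren`). -/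
private theorem le_sq_wallRate_dsix (hy : 0 < y) : y ≤ wallRate y ^ 2 :=
  le_trans (by rw [pow_one]) ((pow_le_PWB hy.le 1).trans (PWB_le_pow hy 1))

/-- [folklore] The exponent bookkeeping: `(y^{2/3})^k ≤ y^{k − ⌊(k−2)/3⌋}` for `y ≥ 1` (`⌊(k−2)/3⌋ ≤ k/3`). -/
private theorem rpow_two_thirds_pow_le_dsix (hy : 1 ≤ y) (k : ℕ) : (y ^ ((2 : ℝ) / 3)) ^ k ≤ y ^ (k - (k - 2) / 3) := by
  have hy0 : 0 ≤ y := by linarith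
  rw [← Real.rpow_natCast (y ^ ((2 : ℝ) / 3)) k, ← Real.rpow_mul hy0, ← Real.rpow_natCast y (k - (k - 2) / 3)]
  refine Real.rpow_le_rpow_of_exponent_le hy ?_
  have h1 : (((k - 2) / 3 : ℕ) : ℝ) ≤ ((k - 2 : ℕ) : ℝ) / 3 := Nat.cast_div_le
  have h2 : ((k - (k - 2) / 3 : ℕ) : ℝ) = (k : ℝ) - (((k - 2) / 3 : ℕ) : ℝ) := by
    rw [Nat.cast_sub]; omega
  have h3 : ((k - 2 : ℕ) : ℝ) ≤ k := by exact_mod_cast Nat.sub_le k 2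
  rw [h2]
  linarith

/-- [folklore] `θ₃(y) = μ²/y^{2/3} > 0` for `y > 0`. -/
private theorem theta_cube_pos_dsix (hy : 0 < y) : 0 < hexConnectiveConstant ^ 2 / y ^ ((2 : ℝ) / 3) :=
  div_pos (pow_pos hexConnectiveConstant_pos 2) (Real.rpow_pos_of_pos hy _)

/-- [folklore] `μ³ < y` forces `1 ≤ y` (`μ ≥ 1`). -/
private theorem one_le_of_mu_cube_lt_dsix (hy : hexConnectiveConstant ^ 3 < y) : 1 ≤ y :=
  (one_le_pow₀ one_le_hexConnectiveConstant).trans hy.le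

/-- **Geometric envelope of the delay law with ratio `θ₃`**: `d_k(y) = D_{2k}/β^{2k} ≤ μ² · (μ²/y^{2/3})^k` for `y ≥ 1` and
every `k` (`β(y)² ≥ y`, the delay six-step envelope, `⌊(k−2)/3⌋ ≤ k/3`). Improves the tree's `dwbLaw_le_geom`
(`μ²√y · (μ²/√y)^k`). NEW. [cite: MadrasSlade1993, §4.2, Theorem 4.2.2 (hypothesis `g < ∞`) and remark before (4.2.21) (p. 94)] -/
theorem dwbLaw_le_geom_cube (hy : 1 ≤ y) (k : ℕ) :
    dwbLaw y k ≤ hexConnectiveConstant ^ 2 * (hexConnectiveConstant ^ 2 / y ^ ((2 : ℝ) / 3)) ^ k := by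
  have hy0 : 0 < y := by linarith
  have hμ := hexConnectiveConstant_pos
  have hr0 : 0 < y ^ ((2 : ℝ) / 3) := Real.rpow_pos_of_pos hy0 _
  have hys : y ^ k ≤ wallRate y ^ (2 * k) := by
    rw [pow_mul]; exact pow_le_pow_left₀ hy0.le (le_sq_wallRate_dsix hy0) k
  have hsplit : y ^ k = y ^ (k - (k - 2) / 3) * y ^ ((k - 2) / 3) := by
    rw [← pow_add]; congr 1; omega
  calc dwbLaw y k ≤ DWB (2 * k) y / y ^ k := div_le_div_of_nonneg_left (DWB_nonneg _ hy0.le) (pow_pos hy0 k) hys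
    _ ≤ hexConnectiveConstant ^ (2 * k + 2) * y ^ ((k - 2) / 3) / y ^ k :=
        div_le_div_of_nonneg_right (DWB_le_pow_mul_pow_sub_div_three hy k) (pow_nonneg hy0.le k)
    _ = hexConnectiveConstant ^ 2 * (hexConnectiveConstant ^ (2 * k) / y ^ (k - (k - 2) / 3)) := by
        rw [hsplit, mul_div_mul_right _ _ (pow_ne_zero _ hy0.ne'), pow_add, pow_mul]
        ring
    _ ≤ hexConnectiveConstant ^ 2 * (hexConnectiveConstant ^ (2 * k) / (y ^ ((2 : ℝ) / 3)) ^ k) :=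
        mul_le_mul_of_nonneg_left (div_le_div_of_nonneg_left (pow_nonneg hμ.le _) (pow_pos hr0 k)
          (rpow_two_thirds_pow_le_dsix hy k)) (pow_nonneg hμ.le 2)
    _ = _ := by rw [div_pow, pow_mul]

/-- **The delay law is summable for `y > μ³`**, with `d(y) = Σ_k d_k(y) ≤ μ²/(1 − θ₃(y))`.
[cite: MadrasSlade1993, §4.2, Theorem 4.2.2 (hypothesis `g < ∞`)] -/
theorem hasSum_dwbLaw_le_of_cube_lt (hy : hexConnectiveConstant ^ 3 < y) :
    Summable (dwbLaw y) ∧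
      dwbSum y ≤ hexConnectiveConstant ^ 2 / (1 - hexConnectiveConstant ^ 2 / y ^ ((2 : ℝ) / 3)) := by
  have hy1 := one_le_of_mu_cube_lt_dsix hy
  have hy0 : 0 < y := by linarith
  have hθ0 := theta_cube_pos_dsix hy0
  have hθ1 := theta_cube_lt_one hy
  set θ := hexConnectiveConstant ^ 2 / y ^ ((2 : ℝ) / 3) with hθ
  set C := hexConnectiveConstant ^ 2 with hC
  have hgeom : HasSum (fun k : ℕ => C * θ ^ k) (C / (1 - θ)) := by
    rw [div_eq_mul_inv]
    exact (hasSum_geometric_of_lt_one hθ0.le hθ1).mul_left C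
  have hsum : Summable (dwbLaw y) :=
    Summable.of_nonneg_of_le (dwbLaw_nonneg hy0.le) (dwbLaw_le_geom_cube hy1) hgeom.summable
  exact ⟨hsum, hgeom.tsum_eq ▸ Summable.tsum_le_tsum (dwbLaw_le_geom_cube hy1) hsum hgeom.summable⟩

/-- `Σ_k d_k(y)` converges for `y > μ³`. [cite: MadrasSlade1993, §4.2, Theorem 4.2.2] -/
theorem summable_dwbLaw_of_cube_lt (hy : hexConnectiveConstant ^ 3 < y) : Summable (dwbLaw y) :=
  (hasSum_dwbLaw_le_of_cube_lt hy).1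

/-- `1 ≤ d(y)` for `y > μ³` (`d_0 = 1`). [cite: MadrasSlade1993, §4.2, Theorem 4.2.2 (`g > 0`)] -/
theorem one_le_dwbSum_of_cube_lt (hy : hexConnectiveConstant ^ 3 < y) : 1 ≤ dwbSum y := by
  have hy0 : 0 < y := by linarith [one_le_of_mu_cube_lt_dsix hy]
  rw [← dwbLaw_zero (y := y), dwbSum]
  exact (summable_dwbLaw_of_cube_lt hy).le_tsum 0 fun k _ => dwbLaw_nonneg hy0.le k

/-- `d(y) ≤ μ²/(1 − μ²/y^{2/3})` for `y > μ³`. [cite: MadrasSlade1993, §4.2, Theorem 4.2.2] -/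
theorem dwbSum_le_of_cube_lt (hy : hexConnectiveConstant ^ 3 < y) :
    dwbSum y ≤ hexConnectiveConstant ^ 2 / (1 - hexConnectiveConstant ^ 2 / y ^ ((2 : ℝ) / 3)) :=
  (hasSum_dwbLaw_le_of_cube_lt hy).2

/-- **The delayed renewal theorem for adsorbed wall bridges down to `y > μ³ = (2+√2)^{3/2}`**:
`W_{2s}(y)/β(y)^{2s} → d(y)/m(y)` — PURE EXPONENTIAL GROWTH OF ALL WALL BRIDGES on `y > μ³` (tree's `tendsto_wbAmp`:
`y > μ⁴`). Madras–Slade Theorem 4.2.2(b) with delay `g = d` and the wall-renewal law, via the tree's dominated-convergence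
lemma, `summable_dwbLaw_of_cube_lt` and `tendsto_pwbAmp_of_cube_lt` of `HexSAWSurfaceWallRenewalCubeRange`. NEW (range extension).
[cite: MadrasSlade1993, §4.2, Theorem 4.2.2(b) (p. 91) and Appendix B, Theorem B.1 (pp. 389–392)]
[cite: Feller1968, XIII.3 and XIII.5 (delayed recurrent events)] [cite: HammersleyTorrieWhittington1982, §2] -/
theorem tendsto_wbAmp_of_cube_lt (hy : hexConnectiveConstant ^ 3 < y) :
    Tendsto (wbAmp y) atTop (𝓝 (dwbSum y * (pwbMean y)⁻¹)) := by
  have hy1 := one_le_of_mu_cube_lt_dsix hy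
  have hy0 : 0 < y := by linarith
  have h := Literature.Probability.Process.Renewal.tendsto_sum_antidiagonal_mul (g := dwbLaw y) (u := pwbAmp y)
    (dwbLaw_nonneg hy0.le) (summable_dwbLaw_of_cube_lt hy) (B := 1)
    (fun n => by rw [abs_of_nonneg (pwbAmp_nonneg hy0.le n)]; exact pwbAmp_le_one hy0 n) (tendsto_pwbAmp_of_cube_lt hy)
  exact h.congr fun s => (wbAmp_eq_sum_antidiagonal s).symm

/-- The limit is positive and explicit on `y > μ³`: `1/m(y) ≤ d(y)/m(y) ≤ μ²/((1−θ₃) m(y))`.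
[cite: MadrasSlade1993, §4.2, Theorem 4.2.2(b)] -/
theorem wbAmp_lim_bounds_of_cube_lt (hy : hexConnectiveConstant ^ 3 < y) :
    (pwbMean y)⁻¹ ≤ dwbSum y * (pwbMean y)⁻¹ ∧ 0 < dwbSum y * (pwbMean y)⁻¹ ∧
      dwbSum y * (pwbMean y)⁻¹ ≤
        hexConnectiveConstant ^ 2 / (1 - hexConnectiveConstant ^ 2 / y ^ ((2 : ℝ) / 3)) * (pwbMean y)⁻¹ := by
  have hm := inv_pos.2 (pwbMean_pos_of_cube_lt hy)
  have hd := one_le_dwbSum_of_cube_lt hy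
  exact ⟨le_mul_of_one_le_left hm.le hd, mul_pos (one_pos.trans_le hd) hm,
    mul_le_mul_of_nonneg_right (dwbSum_le_of_cube_lt hy) hm.le⟩

/-- **Ratio limit for all wall bridges down to `y > μ³`**: `W_{2s+2}(y)/W_{2s}(y) → β(y)²`.
[cite: MadrasSlade1993, §4.2, Theorem 4.2.2(b)] [cite: HammersleyTorrieWhittington1982, §2] -/
theorem tendsto_WB_ratio_of_cube_lt (hy : hexConnectiveConstant ^ 3 < y) :
    Tendsto (fun s : ℕ => WB (2 * s + 2) y / WB (2 * s) y) atTop (𝓝 (wallRate y ^ 2)) := by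
  have hy1 := one_le_of_mu_cube_lt_dsix hy
  have hy0 : 0 < y := by linarith
  have hL : dwbSum y * (pwbMean y)⁻¹ ≠ 0 := (wbAmp_lim_bounds_of_cube_lt hy).2.1.ne'
  have h1 := (((tendsto_wbAmp_of_cube_lt hy).comp (tendsto_add_atTop_nat 1)).div (tendsto_wbAmp_of_cube_lt hy) hL).const_mul
    (wallRate y ^ 2)
  rw [div_self hL, mul_one] at h1
  refine h1.congr fun s => ?_
  have hW : WB (2 * s) y ≠ 0 := (WB_pos hy0 s).ne'
  have hβ : wallRate y ≠ 0 := (wallRate_pos y).ne'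
  show wallRate y ^ 2 * (wbAmp y (s + 1) / wbAmp y s) = WB (2 * s + 2) y / WB (2 * s) y
  rw [wbAmp, wbAmp, show 2 * (s + 1) = 2 * s + 2 by ring]
  field_simp
  ring

/-- **Eventual two-sided constants on `y > μ³`**: for every `ε > 0`, eventually
`(d/m − ε) β^{2s} ≤ W_{2s}(y) ≤ (d/m + ε) β^{2s}`. [cite: MadrasSlade1993, §4.2, Theorem 4.2.2(b)] -/
theorem eventually_WB_two_sided_of_cube_lt (hy : hexConnectiveConstant ^ 3 < y) {ε : ℝ} (hε : 0 < ε) :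
    ∀ᶠ s : ℕ in atTop, (dwbSum y * (pwbMean y)⁻¹ - ε) * wallRate y ^ (2 * s) ≤ WB (2 * s) y ∧
      WB (2 * s) y ≤ (dwbSum y * (pwbMean y)⁻¹ + ε) * wallRate y ^ (2 * s) := by
  have h := (tendsto_wbAmp_of_cube_lt hy).eventually (Metric.ball_mem_nhds _ hε)
  filter_upwards [h] with s hs
  rw [Real.dist_eq, abs_lt] at hs
  have hβ := pow_pos (wallRate_pos y) (2 * s)
  have he : WB (2 * s) y = wbAmp y s * wallRate y ^ (2 * s) := by rw [wbAmp, div_mul_cancel₀ _ hβ.ne']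
  rw [he]
  exact ⟨mul_le_mul_of_nonneg_right (by linarith) hβ.le, mul_le_mul_of_nonneg_right (by linarith) hβ.le⟩

/-- **All-`s` sandwich on `y > μ³`** (no limit needed): `(2 − m(y)) β^{2s} ≤ W_{2s} ≤ (β²/y) β^{2s}`.
[cite: MadrasSlade1993, §4.2, Theorem 4.2.2(b) and §1.2, Lemma 1.2.2] -/
theorem WB_two_sided_all_of_cube_lt (hy : hexConnectiveConstant ^ 3 < y) (s : ℕ) :
    (2 - pwbMean y) * wallRate y ^ (2 * s) ≤ WB (2 * s) y ∧ WB (2 * s) y ≤ wallRate y ^ 2 / y * wallRate y ^ (2 * s) := by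
  have hy0 : 0 < y := by linarith [one_le_of_mu_cube_lt_dsix hy]
  exact ⟨two_sub_pwbMean_mul_pow_le_WB_of_cube_lt hy s, WB_le_pow hy0 (2 * s)⟩


/-! ### §5 The delay gap: no delay pieces of lengths `1, …, 9`; the delay mass is `1 + O(θ₃⁵)` -/

/-- A delay piece of length `n ≥ 1` has at least one surface visit (its endpoint: `n` is even and `Y_n = 0`).
[cite: MadrasSlade1993, §4.2, Theorem 4.2.2 (the delay sequence); HammersleyTorrieWhittington1982, §2] -/
theorem one_le_visits_of_mem_dwb (hω : ω ∈ dwb n) (hn : 1 ≤ n) : 1 ≤ visits n ω := by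
  classical
  obtain ⟨hw, -⟩ := mem_dwb.1 hω
  obtain ⟨ha, -⟩ := mem_wbr.1 hw
  obtain ⟨-, hn2, hYn⟩ := mem_archs.1 ha
  rw [visits_eq_card]
  exact Finset.card_pos.2 ⟨n, by rw [wallTimes, Finset.mem_filter, Finset.mem_Icc]; exact ⟨⟨hn, le_rfl⟩, hn2, hYn⟩⟩

/-- **The delay gap**: every delay piece of positive length has length `≥ 10` (`6·visits + 4 ≤ n` with `visits ≥ 1`); the shortest
one is the ten-step hook with a dive to column `0`. [cite: MadrasSlade1993, §4.2, Theorem 4.2.2 (the delay sequence `g_n`)] -/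
theorem ten_le_of_mem_dwb (hω : ω ∈ dwb n) (hn : 1 ≤ n) : 10 ≤ n := by
  have h1 := one_le_visits_of_mem_dwb hω hn
  have h2 := six_mul_visits_add_four_le_dwb hω hn
  omega

/-- No delay pieces of lengths `1, …, 9`. [cite: MadrasSlade1993, §4.2, Theorem 4.2.2 (the delay sequence `g_n`)] -/
theorem dwb_eq_empty_of_lt_ten (hn1 : 1 ≤ n) (hn : n < 10) : dwb n = ∅ :=
  Finset.eq_empty_of_forall_notMem fun _ hω => absurd (ten_le_of_mem_dwb hω hn1) (by omega)

/-- `D_n(y) = 0` for `1 ≤ n ≤ 9`. [cite: MadrasSlade1993, §4.2, Theorem 4.2.2 (`g_n`)] -/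
theorem DWB_eq_zero_of_lt_ten (hn1 : 1 ≤ n) (hn : n < 10) (y : ℝ) : DWB n y = 0 := by
  rw [DWB, dwb_eq_empty_of_lt_ten hn1 hn, Finset.sum_empty]

/-- `d_k(y) = 0` for `1 ≤ k ≤ 4`. [cite: MadrasSlade1993, §4.2, Theorem 4.2.2 (`g_n`)] -/
theorem dwbLaw_eq_zero_of_lt_five {k : ℕ} (hk1 : 1 ≤ k) (hk : k < 5) (y : ℝ) : dwbLaw y k = 0 := by
  rw [dwbLaw, DWB_eq_zero_of_lt_ten (by omega) (by omega), zero_div]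

/-- **The delay mass is `1 + O(θ₃⁵)`**: `d(y) − 1 ≤ μ² θ₃(y)⁵/(1 − θ₃(y))` for `y > μ³` (`d_0 = 1`, `d_1 = ⋯ = d_4 = 0`, and the
geometric envelope `d_k ≤ μ² θ₃^k` from `k = 5` on). With `one_le_dwbSum_of_cube_lt`: `|d(y) − 1| ≤ μ²θ₃⁵/(1−θ₃)`.
[cite: MadrasSlade1993, §4.2, Theorem 4.2.2 (hypothesis `g < ∞`) and remark before (4.2.21) (p. 94)] -/
theorem dwbSum_sub_one_le_of_cube_lt (hy : hexConnectiveConstant ^ 3 < y) :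
    dwbSum y - 1 ≤ hexConnectiveConstant ^ 2 * (hexConnectiveConstant ^ 2 / y ^ ((2 : ℝ) / 3)) ^ 5 /
      (1 - hexConnectiveConstant ^ 2 / y ^ ((2 : ℝ) / 3)) := by
  have hy1 := one_le_of_mu_cube_lt_dsix hy
  have hy0 : 0 < y := by linarith
  set θ := hexConnectiveConstant ^ 2 / y ^ ((2 : ℝ) / 3) with hθ
  have hθ0 : 0 < θ := theta_cube_pos_dsix hy0
  have hθ1 : θ < 1 := theta_cube_lt_one hy
  set C := hexConnectiveConstant ^ 2 with hC
  have hsum := summable_dwbLaw_of_cube_lt hy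
  -- split off the first five terms: `d_0 + … + d_4 = 1`
  have hsplit := hsum.sum_add_tsum_nat_add 5
  have hhead : ∑ k ∈ range 5, dwbLaw y k = 1 := by
    rw [Finset.sum_range_succ, Finset.sum_range_succ, Finset.sum_range_succ, Finset.sum_range_succ, Finset.sum_range_one,
      dwbLaw_zero, dwbLaw_eq_zero_of_lt_five (by norm_num) (by norm_num), dwbLaw_eq_zero_of_lt_five (by norm_num) (by norm_num),
      dwbLaw_eq_zero_of_lt_five (by norm_num) (by norm_num), dwbLaw_eq_zero_of_lt_five (by norm_num) (by norm_num)]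
    ring
  have hshift : Summable fun k => dwbLaw y (k + 5) := (summable_nat_add_iff 5).2 hsum
  have hgeo : Summable fun k : ℕ => C * θ ^ 5 * θ ^ k := (summable_geometric_of_lt_one hθ0.le hθ1).mul_left _
  have htail : ∑' k, dwbLaw y (k + 5) ≤ C * θ ^ 5 * (1 - θ)⁻¹ := by
    calc ∑' k, dwbLaw y (k + 5) ≤ ∑' k : ℕ, C * θ ^ 5 * θ ^ k := by
          refine Summable.tsum_le_tsum (fun k => ?_) hshift hgeo
          calc dwbLaw y (k + 5) ≤ C * θ ^ (k + 5) := dwbLaw_le_geom_cube hy1 _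
            _ = C * θ ^ 5 * θ ^ k := by rw [pow_add]; ring
      _ = C * θ ^ 5 * (1 - θ)⁻¹ := by rw [tsum_mul_left, tsum_geometric_of_lt_one hθ0.le hθ1]
  rw [dwbSum, ← hsplit, hhead, div_eq_mul_inv]
  linarith

/-- **The delayed amplitude is the positive-bridge amplitude up to `O(θ₃⁵)`**: for `y > μ³` the limit `d(y)/m(y)` of
`W_{2s}(y)/β(y)^{2s}` satisfies `1/m(y) ≤ d(y)/m(y) ≤ (1 + μ²θ₃⁵/(1−θ₃))/m(y)` — all wall bridges and positive wall bridges have the same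
pure-exponential amplitude to relative order `θ₃(y)⁵ = μ^{10}/y^{10/3}`. [cite: MadrasSlade1993, §4.2, Theorem 4.2.2(b) (p. 91)]
[cite: HammersleyTorrieWhittington1982, §2] -/
theorem wbAmp_lim_window_of_cube_lt (hy : hexConnectiveConstant ^ 3 < y) :
    (pwbMean y)⁻¹ ≤ dwbSum y * (pwbMean y)⁻¹ ∧
      dwbSum y * (pwbMean y)⁻¹ ≤ (1 + hexConnectiveConstant ^ 2 * (hexConnectiveConstant ^ 2 / y ^ ((2 : ℝ) / 3)) ^ 5 /
        (1 - hexConnectiveConstant ^ 2 / y ^ ((2 : ℝ) / 3))) * (pwbMean y)⁻¹ := by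
  have hm := inv_pos.2 (pwbMean_pos_of_cube_lt hy)
  have hd := one_le_dwbSum_of_cube_lt hy
  have hd' := dwbSum_sub_one_le_of_cube_lt hy
  exact ⟨le_mul_of_one_le_left hm.le hd, mul_le_mul_of_nonneg_right (by linarith) hm.le⟩

end Literature.Probability.RandomPlanarGeometry.SAW.HexBW.Wall
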